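import Summits.QuantumFields.BalabanUV.Beta.EriceFlowEnclosureCesaroClockSampling
import Summits.QuantumFields.BalabanUV.Beta.EriceFlowEnclosureCesaroTauberianSeqRate

/-!
# Beta / EriceFlowEnclosureCesaroClockSamplingRate — RATES FOR THE CUTOFF AVERAGE: WITH A CLOCK RATE `|n·h_n − L₀| ≤ λL₀` THE SAMPLED
# LOG-LIPSCHITZ FUNCTION IS LOG-LIPSCHITZ IN n UP TO THE SLACK 4Cλ, AND A CESÀRO-OVER-CUTOFFS RATE E FOR THE DEVIATION'S PRINCIPAL PART
# `u_n = c·(M(h_n) − m)` IS UNDONE AT THE COST OF A SQUARE ROOT:  **`|c|·|M(h_N) − m| ≤ (|c|C + 3)·√E + 4|c|Cλ + (|c|C + 1)∕N`**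
# (pure [folklore] SERVICE — the quantitative twin of P2 #53b; imports P2 #53b + P2 #53d; WINDOWED form: the hypotheses are read on
# [N, 2N] (values, clock) and [N, 3N] (Cesàro means) only and the conclusion is at N, so that any clock rate (row L119: `2B(1 + log K)∕(β₀²K)`) and
# any Cesàro rate can be plugged BY NAME without monotonicity lemmas).
# (β-flow team, prover 2 = lower ∕ positivity side, unit `b2b-balaban-beta-bflow-p2`, gen 36; module P2 #53e; no Erice sentence occurs)

HONEST FRAMING (page 1 of everything the β sub-cell writes): discharging `BetaPertH` makes Bałaban's UV stability UNCONDITIONAL — a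
real constructive-QFT result; it is NOT the continuum limit and NOT the Clay problem.  HONEST DEPENDENCY (cell reorg 2026-08-19,
verbatim): «continuum YM on T⁴ ⇐ BetaPertH ∧ nine spine estimates (0/9 proved); BetaPertH ⇐ (D1) ∧ (D4) ∧ CAP+tail; G-an2-4 gates
asym, D1 and NE2/3/4.»  THIS MODULE DISCHARGES NOTHING and quotes nothing: [folklore] real analysis about a real function M and a positive
sequence h (shapes: M = the three-loop Cesàro mean, 2C₂-log-Lipschitz by P2 #52a; h = the cutoff couplings with the two-loop clock of row L119).

THE POINT.  `log(h_i∕h_N) = log(x_i∕L₀) − log(x_N∕L₀) − log(i∕N)` with `x_n = n·h_n`; for `|x∕L₀ − 1| ≤ λ ≤ 1∕2` one has `|log(x∕L₀)| ≤ 2λ`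
(`log y ≤ y − 1` applied to y and 1∕y), so `|M(h_i) − M(h_N)| ≤ C·log(i∕N) + 4Cλ` on every window from N on — the «asymptotically log-Lipschitz»
hypothesis of P2 #53d `sqrt_law` with slack τ = 4Cλ (times |c| for the principal part of the deviation).

WHAT THIS FILE PROVES (0 sorry, 0 def): §1 `abs_log_le_two_mul`, `abs_log_clock_le`; §2 HEADLINE **`sampled_logLip_of_clockRate`**;
§3 **`sampled_sqrt_law`** (principal part u_n = c·(M(h_n) − m): Cesàro tail rate E ⟹ `|c|·|M(h_N) − m| ≤ (|c|C + 3)√E + 4|c|Cλ + (|c|C + 1)∕N`).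
NOT CLAIMED: the remainder e_n of the deviation (its Cesàro means must be priced separately — by `(1∕N)Σ_{n<N}(1 + log n)²∕n = O((log N)³∕N)` for
row L120's remainder; not filed); the by-name β version (row L119 ∕ L120 plugged in); optimality; `BetaPertH`; continuum; Clay.
-/

namespace Summit.QuantumFields.BalabanUV.Beta.EriceFlowEnclosureCesaroClockSamplingRate

open Finset Filter Topology
open Summit.QuantumFields.BalabanUV.Beta.EriceFlowEnclosureCesaroClockSampling (logLip_abs)
open Summit.QuantumFields.BalabanUV.Beta.EriceFlowEnclosureCesaroTauberianSeqRate (sqrt_law)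

noncomputable section

variable {M : ℝ → ℝ} {h : ℕ → ℝ} {δ C L₀ : ℝ}

/-! ## §1 Logarithms near 1 -/

/-- `|y − 1| ≤ λ ≤ 1∕2` ⟹ `|log y| ≤ 2λ` (upper: `log y ≤ y − 1 ≤ λ`; lower: `−log y = log y⁻¹ ≤ y⁻¹ − 1 = (1 − y)∕y ≤ λ∕(1 − λ) ≤ 2λ`). [folklore] -/
theorem abs_log_le_two_mul {y l : ℝ} (hl : l ≤ 1 / 2) (hy : |y - 1| ≤ l) : |Real.log y| ≤ 2 * l := by
  have hl0 : 0 ≤ l := (abs_nonneg _).trans hy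
  obtain ⟨hy1, hy2⟩ := abs_le.mp hy
  have hypos : 0 < y := by linarith
  rw [abs_le]; constructor
  · -- −2λ ≤ log y  ⟸  log (1/y) ≤ 1/y − 1 ≤ 2λ
    have h1 : Real.log y⁻¹ ≤ y⁻¹ - 1 := Real.log_le_sub_one_of_pos (inv_pos.mpr hypos)
    have h2 : y⁻¹ - 1 ≤ 2 * l := by
      rw [sub_le_iff_le_add, inv_le_iff_one_le_mul₀ hypos]
      nlinarith
    rw [Real.log_inv] at h1
    linarith
  · exact (Real.log_le_sub_one_of_pos hypos).trans (by linarith)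

/-- The clock in logarithmic form: `|x − L₀| ≤ λL₀` (L₀ > 0, λ ≤ 1∕2) ⟹ `|log x − log L₀| ≤ 2λ`. [folklore] -/
theorem abs_log_clock_le {x l : ℝ} (hL₀ : 0 < L₀) (hl : l ≤ 1 / 2) (hx : |x - L₀| ≤ l * L₀) :
    |Real.log x - Real.log L₀| ≤ 2 * l := by
  have hxpos : 0 < x := by
    have := (abs_le.mp hx).1; nlinarith [mul_nonneg (sub_nonneg.mpr hl) hL₀.le]
  have hy : |x / L₀ - 1| ≤ l := by
    rw [div_sub_one hL₀.ne', abs_div, abs_of_pos hL₀, div_le_iff₀ hL₀]; exact hx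
  have h := abs_log_le_two_mul hl hy
  rwa [Real.log_div hxpos.ne' hL₀.ne'] at h

/-! ## §2 With a clock rate the sampled function is log-Lipschitz in n up to a slack -/

/-- **THE SAMPLED FUNCTION IS LOG-LIPSCHITZ IN n UP TO THE CLOCK'S SLACK (HEADLINE; windowed form).**  If `|M u − M t| ≤ C·log(u∕t)` for
`0 < t ≤ u < δ`, `h_n > 0`, L₀ > 0, and ON THE WINDOW `N ≤ n ≤ W` (N ≥ 1): `h_n < δ` and `|n·h_n − L₀| ≤ λL₀` with `λ ≤ 1∕2`, then for all
`N ≤ N' ≤ i ≤ W`: **`|M(h_i) − M(h_N')| ≤ C·log(i∕N') + 4Cλ`** (no monotonicity of h;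
`log(h_i∕h_N') = (log x_i − log L₀) − (log x_N' − log L₀) − log(i∕N')`). [folklore] -/
theorem sampled_logLip_of_clockRate (hC : 0 ≤ C)
    (hlip : ∀ t u : ℝ, 0 < t → t ≤ u → u < δ → |M u - M t| ≤ C * Real.log (u / t))
    (hpos : ∀ n, 0 < h n) (hL₀ : 0 < L₀) {N W : ℕ} (hN1 : 1 ≤ N) {l : ℝ} (hl : l ≤ 1 / 2)
    (hδN : ∀ n, N ≤ n → n ≤ W → h n < δ) (hclockN : ∀ n : ℕ, N ≤ n → n ≤ W → |(n : ℝ) * h n - L₀| ≤ l * L₀) :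
    ∀ N' i : ℕ, N ≤ N' → N' ≤ i → i ≤ W → |M (h i) - M (h N')| ≤ C * Real.log ((i : ℝ) / N') + 4 * C * l := by
  intro N' i hN hN'i hiW
  have hN'pos : 0 < (N' : ℝ) := Nat.cast_pos.mpr (lt_of_lt_of_le Nat.one_pos (hN1.trans hN))
  have hipos : 0 < (i : ℝ) := lt_of_lt_of_le hN'pos (Nat.cast_le.mpr hN'i)
  have hxN := abs_log_clock_le hL₀ hl (hclockN N' hN (hN'i.trans hiW))
  have hxi := abs_log_clock_le hL₀ hl (hclockN i (hN.trans hN'i) hiW)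
  have hlogq0 : 0 ≤ Real.log ((i : ℝ) / N') := Real.log_nonneg ((one_le_div hN'pos).mpr (Nat.cast_le.mpr hN'i))
  have hident : Real.log (h i / h N') =
      (Real.log ((i : ℝ) * h i) - Real.log L₀) - (Real.log ((N' : ℝ) * h N') - Real.log L₀) - Real.log ((i : ℝ) / N') := by
    rw [Real.log_div (hpos i).ne' (hpos N').ne', Real.log_mul hipos.ne' (hpos i).ne',
      Real.log_mul hN'pos.ne' (hpos N').ne', Real.log_div hipos.ne' hN'pos.ne']
    ring
  have habs : |Real.log (h i / h N')| ≤ Real.log ((i : ℝ) / N') + 4 * l := by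
    rw [hident]
    calc |Real.log ((i : ℝ) * h i) - Real.log L₀ - (Real.log ((N' : ℝ) * h N') - Real.log L₀) - Real.log ((i : ℝ) / N')|
        ≤ |Real.log ((i : ℝ) * h i) - Real.log L₀ - (Real.log ((N' : ℝ) * h N') - Real.log L₀)| + |Real.log ((i : ℝ) / N')| :=
          abs_sub _ _
      _ ≤ (|Real.log ((i : ℝ) * h i) - Real.log L₀| + |Real.log ((N' : ℝ) * h N') - Real.log L₀|) + |Real.log ((i : ℝ) / N')| := by
          gcongr; exact abs_sub _ _
      _ ≤ (2 * l + 2 * l) + Real.log ((i : ℝ) / N') := by rw [abs_of_nonneg hlogq0]; gcongr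
      _ = Real.log ((i : ℝ) / N') + 4 * l := by ring
  calc |M (h i) - M (h N')| ≤ C * |Real.log (h i / h N')| :=
        logLip_abs hlip (hpos N') (hδN N' hN (hN'i.trans hiW)) (hpos i) (hδN i (hN.trans hN'i) hiW)
    _ ≤ C * (Real.log ((i : ℝ) / N') + 4 * l) := mul_le_mul_of_nonneg_left habs hC
    _ = C * Real.log ((i : ℝ) / N') + 4 * C * l := by ring

/-! ## §3 The square-root law for the cutoff average of the deviation's principal part -/

/-- **UNDOING THE CUTOFF AVERAGE COSTS A SQUARE ROOT (windowed form; everything between N and 3N).**  Log-Lipschitz M with constant C ≥ 0;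
on the window `N ≤ n ≤ 2N` (N ≥ 1): `h_n < δ` and the clock slack `|n·h_n − L₀| ≤ λL₀`, `λ ≤ 1∕2`; `u_n := c·(M(h_n) − m)` with Cesàro means
`|n⁻¹·Σ_{i<n} u_i| ≤ E` for `N ≤ n ≤ 3N`, `0 < E ≤ 1`.  Then **`|c|·|M(h_N) − m| ≤ (|c|C + 3)·√E + 4|c|Cλ + (|c|C + 1)∕N`** — P2 #53d `sqrt_law`
on u with K = |c|C, τ = 4|c|Cλ. [folklore] -/
theorem sampled_sqrt_law (hC : 0 ≤ C)
    (hlip : ∀ t u : ℝ, 0 < t → t ≤ u → u < δ → |M u - M t| ≤ C * Real.log (u / t))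
    (hpos : ∀ n, 0 < h n) (hL₀ : 0 < L₀) {N : ℕ} (hN1 : 1 ≤ N) {l : ℝ} (hl : l ≤ 1 / 2)
    (hδN : ∀ n, N ≤ n → n ≤ 2 * N → h n < δ) (hclockN : ∀ n : ℕ, N ≤ n → n ≤ 2 * N → |(n : ℝ) * h n - L₀| ≤ l * L₀)
    {c m E : ℝ} (hE0 : 0 < E) (hE1 : E ≤ 1)
    (hces : ∀ n : ℕ, N ≤ n → n ≤ 3 * N → |(n : ℝ)⁻¹ * ∑ i ∈ range n, c * (M (h i) - m)| ≤ E) :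
    |c| * |M (h N) - m| ≤ (|c| * C + 3) * Real.sqrt E + 4 * |c| * C * l + (|c| * C + 1) / N := by
  have hwin := sampled_logLip_of_clockRate hC hlip hpos hL₀ hN1 hl hδN hclockN
  -- u is log-Lipschitz on the window [N, 2N] with K = |c| C and slack 4|c|Cλ
  have hlipu : ∀ i : ℕ, N ≤ i → i ≤ 2 * N →
      |c * (M (h i) - m) - c * (M (h N) - m)| ≤ |c| * C * Real.log ((i : ℝ) / N) + 4 * |c| * C * l := by
    intro i h1 h2
    have hw := hwin N i le_rfl h1 h2
    calc |c * (M (h i) - m) - c * (M (h N) - m)| = |c| * |M (h i) - M (h N)| := by rw [← abs_mul]; ring_nf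
      _ ≤ |c| * (C * Real.log ((i : ℝ) / N) + 4 * C * l) := mul_le_mul_of_nonneg_left hw (abs_nonneg c)
      _ = |c| * C * Real.log ((i : ℝ) / N) + 4 * |c| * C * l := by ring
  have hces' : ∀ n : ℕ, N ≤ n → n ≤ 3 * N → |(n : ℝ)⁻¹ * ∑ i ∈ range n, c * (M (h i) - m) - 0| ≤ E :=
    fun n hn hn3 => by rw [sub_zero]; exact hces n hn hn3
  have h := sqrt_law (a := fun n => c * (M (h n) - m)) (by positivity : 0 ≤ |c| * C) hN1 hE0 hE1 hlipu hces'
  rw [sub_zero, abs_mul] at h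
  exact h

end

end Summit.QuantumFields.BalabanUV.Beta.EriceFlowEnclosureCesaroClockSamplingRate
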